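import Mathlib
import Summits.ValiantsHypothesis.ValiantsHypothesis.Theorems.LacunarySymmetroidMatrixDescartesGramDualSigned

/-!
# `MatrixDescartes` (stmt-ValiantsHypothesis-18050) — Gram duality, part 11: THE CRUX'S OWN CURRENCY — every
# lacunary symmetric pencil `Σ_l X^{d_l} S_l` with ONE non-degenerate letter is a base-plus-signed-column word,
# hence root-equivalent to its Gram dual

HONEST FRAMING.  Cell `pub-symmetroid`, seat `val-sym-mdr-p2` (gen 19); helper file `--supports` the crux
`Theses.LacunarySymmetroid.MatrixDescartes` (OPEN), NO closure claim; companion of `…GramDualSigned`.  It writes the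
crux's pencils `Σ_{l<K} X^{d_l} S_l` (`S_l` real symmetric `m × m`) in the signed column form of the Gram-duality files,
so that all their laws (same positive zeros as the dual, splitting, frame, effective size) apply verbatim to pencils
as typed in `Theses.LacunarySymmetroid.MatrixDescartes`.  Nothing here bears on the crux in its window,
`stub_twoSided`, `DoorA26` / `DoorA34`, registers, or `VP ≠ VNP`.

* **`pencil_eq_base_add_signedPart` (SIGNED COLUMN FORM OF A PENCIL).**  For symmetric (= hermitian over `ℝ`)
  letters `S_l` and any distinguished index `l₀`:
  `Σ_l X^{d_l} S_l = X^{d_{l₀}} S_{l₀} + U · diag(σ_t X^{δ_t}) · Uᵀ`, the columns `t = (l, i)` running over the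
  eigenvectors `i` of the letters `l ≠ l₀` with NON-ZERO eigenvalue, `U_{·,t}` = that eigenvector, `σ_t` = its
  eigenvalue, `δ_t = d_l` (spectral theorem letter by letter; zero eigenvalues dropped so that all signs are non-zero).
* **`card_posRoots_pencil_eq_dual` (GRAM DUALITY FOR PENCILS).**  If moreover `det S_{l₀} ≠ 0` and `d_l ≤ E` for all
  `l`, then `Z₊(Σ_l X^{d_l} S_l) = Z₊(diag(σ_t⁻¹ X^{E−d_l(t)}) + X^{E−d_{l₀}} · UᵀS_{l₀}⁻¹U)`: the pencil has the positive
  zeros of a pencil of size `#{(l,i) : l ≠ l₀, λ_{l,i} ≠ 0} = Σ_{l≠l₀} rank S_l` whose letters are signed coordinate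
  projectors (one per exponent `d_l`, `l ≠ l₀`) and ONE constant letter — the Gram matrix of all eigen-columns of the
  other letters in the metric `S_{l₀}⁻¹` — at the (reversed) exponent of `S_{l₀}`.
  (`card_cols_eq_sum_rank`: the dual size is `Σ_{l ≠ l₀} rank S_l`.)

[folklore] (spectral theorem + Sylvester).  Axioms `propext`, `Classical.choice`, `Quot.sound`.
-/

-- layout Summits/ValiantsHypothesis/ValiantsHypothesis forces the duplicated namespace component
set_option linter.dupNamespace false

namespace Summit.ValiantsHypothesis.ValiantsHypothesis.Theorems.LacunarySymmetroidMatrixDescartes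

open Polynomial Matrix Finset
open scoped BigOperators

namespace GramDual

/-- the signed column part (file-local notation, as in `…GramDualSigned`) -/
local notation3 (prettyPrint := false) "𝕊[" U ", " σ ", " δ "]" =>
  ((U : Matrix _ _ ℝ).map Polynomial.C
      * Matrix.diagonal (fun j => Polynomial.C ((σ : _ → ℝ) j) * (Polynomial.X : Polynomial ℝ) ^ (δ j : ℕ))
      * ((U : Matrix _ _ ℝ).map Polynomial.C)ᵀ)

/-- the signed primal word (file-local notation, as in `…GramDualSigned`) -/
local notation3 (prettyPrint := false) "𝔽ₛ[" e ", " B ", " U ", " σ ", " δ "]" =>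
  (((Polynomial.X : Polynomial ℝ) ^ (e : ℕ)) • (B : Matrix _ _ ℝ).map Polynomial.C + 𝕊[U, σ, δ])

/-- the signed dual word (file-local notation, as in `…GramDualSigned`) -/
local notation3 (prettyPrint := false) "𝔻ₛ[" E ", " e ", " B ", " U ", " σ ", " δ "]" =>
  (Matrix.diagonal (fun j => Polynomial.C (((σ : _ → ℝ) j)⁻¹) * (Polynomial.X : Polynomial ℝ) ^ ((E : ℕ) - δ j))
    + ((Polynomial.X : Polynomial ℝ) ^ ((E : ℕ) - (e : ℕ))) •
      ((U : Matrix _ _ ℝ)ᵀ * (B : Matrix _ _ ℝ)⁻¹ * (U : Matrix _ _ ℝ)).map Polynomial.C)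

variable {K m : ℕ}

/-- Entry formula of a symmetric letter through its eigen-decomposition:
`(S l) a b = Σ_i P_{a i} λ_i P_{b i}`. [folklore] -/
theorem letter_apply_eq_sum (S : Fin K → Matrix (Fin m) (Fin m) ℝ) (hS : ∀ l, (S l).IsHermitian) (l : Fin K)
    (a b : Fin m) :
    S l a b = ∑ i, ((hS l).eigenvectorUnitary : Matrix (Fin m) (Fin m) ℝ) a i * (hS l).eigenvalues i
      * ((hS l).eigenvectorUnitary : Matrix (Fin m) (Fin m) ℝ) b i := by
  set P : Matrix (Fin m) (Fin m) ℝ := ((hS l).eigenvectorUnitary : Matrix (Fin m) (Fin m) ℝ) with hP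
  have hCeq : S l = P * Matrix.diagonal (hS l).eigenvalues * star P := by
    simpa [Unitary.conjStarAlgAut_apply, hP] using (hS l).spectral_theorem
  conv_lhs => rw [hCeq]
  rw [Matrix.mul_apply]
  refine Finset.sum_congr rfl fun i _ => ?_
  rw [Matrix.mul_diagonal, Matrix.star_apply, star_trivial]

/-- **SIGNED COLUMN FORM OF A PENCIL.**  `Σ_l X^{d_l} S_l = X^{d_{l₀}} S_{l₀} + U diag(σ X^δ) Uᵀ` with columns the
eigenvectors of non-zero eigenvalue of the letters `l ≠ l₀`, signs the eigenvalues, exponents `d_l`. [folklore] -/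
theorem pencil_eq_base_add_signedPart (d : Fin K → ℕ) (S : Fin K → Matrix (Fin m) (Fin m) ℝ)
    (hS : ∀ l, (S l).IsHermitian) (l₀ : Fin K) :
    (∑ l, ((Polynomial.X : Polynomial ℝ) ^ d l) • (S l).map Polynomial.C)
      = ((Polynomial.X : Polynomial ℝ) ^ d l₀) • (S l₀).map Polynomial.C
        + 𝕊[(Matrix.of fun (a : Fin m) (t : {li : Fin K × Fin m // li.1 ≠ l₀ ∧ (hS li.1).eigenvalues li.2 ≠ 0}) =>
              ((hS t.1.1).eigenvectorUnitary : Matrix (Fin m) (Fin m) ℝ) a t.1.2),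
            (fun t : {li : Fin K × Fin m // li.1 ≠ l₀ ∧ (hS li.1).eigenvalues li.2 ≠ 0} =>
              (hS t.1.1).eigenvalues t.1.2),
            (fun t : {li : Fin K × Fin m // li.1 ≠ l₀ ∧ (hS li.1).eigenvalues li.2 ≠ 0} => d t.1.1)] := by
  classical
  -- abbreviations
  set P : Fin K → Matrix (Fin m) (Fin m) ℝ := fun l => ((hS l).eigenvectorUnitary : Matrix (Fin m) (Fin m) ℝ)
    with hP
  set lam : Fin K → Fin m → ℝ := fun l => (hS l).eigenvalues with hlam
  -- the summand of letter `l`, entry `(a,b)`, as a sum over eigen-columns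
  have hletter : ∀ l (a b : Fin m), (((Polynomial.X : Polynomial ℝ) ^ d l) • (S l).map Polynomial.C) a b
      = ∑ i, Polynomial.C (P l a i) * (Polynomial.C (lam l i) * (Polynomial.X : Polynomial ℝ) ^ d l)
          * Polynomial.C (P l b i) := by
    intro l a b
    rw [Matrix.smul_apply, Matrix.map_apply, letter_apply_eq_sum S hS l a b, map_sum, smul_eq_mul,
      Finset.mul_sum]
    refine Finset.sum_congr rfl fun i _ => ?_
    rw [map_mul, map_mul]
    ring
  refine Matrix.ext fun a b => ?_
  rw [Matrix.add_apply, Matrix.sum_apply, ← Finset.add_sum_erase _ _ (Finset.mem_univ l₀)]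
  congr 1
  -- right side: the signed column part, entry `(a,b)`
  have hR : (𝕊[(Matrix.of fun (a : Fin m) (t : {li : Fin K × Fin m // li.1 ≠ l₀ ∧ (hS li.1).eigenvalues li.2 ≠ 0}) =>
              P t.1.1 a t.1.2),
            (fun t : {li : Fin K × Fin m // li.1 ≠ l₀ ∧ (hS li.1).eigenvalues li.2 ≠ 0} => lam t.1.1 t.1.2),
            (fun t : {li : Fin K × Fin m // li.1 ≠ l₀ ∧ (hS li.1).eigenvalues li.2 ≠ 0} => d t.1.1)]) a b
      = ∑ t : {li : Fin K × Fin m // li.1 ≠ l₀ ∧ (hS li.1).eigenvalues li.2 ≠ 0},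
          Polynomial.C (P t.1.1 a t.1.2) * (Polynomial.C (lam t.1.1 t.1.2) * (Polynomial.X : Polynomial ℝ) ^ d t.1.1)
            * Polynomial.C (P t.1.1 b t.1.2) := by
    rw [Matrix.mul_apply]
    refine Finset.sum_congr rfl fun t _ => ?_
    rw [Matrix.mul_diagonal, Matrix.transpose_apply, Matrix.map_apply, Matrix.map_apply, Matrix.of_apply,
      Matrix.of_apply]
  rw [hR]
  -- left side: sum over `l ≠ l₀` and all `i`; drop the zero eigenvalues; reindex by the subtype
  have hL : (∑ l ∈ Finset.univ.erase l₀, (((Polynomial.X : Polynomial ℝ) ^ d l) • (S l).map Polynomial.C) a b)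
      = ∑ li ∈ ((Finset.univ.erase l₀) ×ˢ (Finset.univ : Finset (Fin m))).filter
            (fun li : Fin K × Fin m => lam li.1 li.2 ≠ 0),
          Polynomial.C (P li.1 a li.2) * (Polynomial.C (lam li.1 li.2) * (Polynomial.X : Polynomial ℝ) ^ d li.1)
            * Polynomial.C (P li.1 b li.2) := by
    rw [Finset.sum_filter_of_ne, Finset.sum_product]
    · exact Finset.sum_congr rfl fun l _ => hletter l a b
    · intro li _ hne h0
      apply hne
      rw [h0, map_zero, zero_mul, mul_zero, zero_mul]
  rw [hL]
  refine Finset.sum_subtype _ (fun li => ?_) (fun li : Fin K × Fin m =>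
    Polynomial.C (P li.1 a li.2) * (Polynomial.C (lam li.1 li.2) * (Polynomial.X : Polynomial ℝ) ^ d li.1)
      * Polynomial.C (P li.1 b li.2))
  simp only [Finset.mem_filter, Finset.mem_product, Finset.mem_erase, Finset.mem_univ, and_true, ne_eq, hlam]

/-- **The dual size is `Σ_{l ≠ l₀} rank S_l`.** [folklore] -/
theorem card_cols_eq_sum_rank (S : Fin K → Matrix (Fin m) (Fin m) ℝ) (hS : ∀ l, (S l).IsHermitian) (l₀ : Fin K) :
    Fintype.card {li : Fin K × Fin m // li.1 ≠ l₀ ∧ (hS li.1).eigenvalues li.2 ≠ 0}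
      = ∑ l ∈ Finset.univ.erase l₀, (S l).rank := by
  classical
  rw [Fintype.card_subtype]
  have h : (Finset.univ.filter fun li : Fin K × Fin m => li.1 ≠ l₀ ∧ (hS li.1).eigenvalues li.2 ≠ 0)
      = (Finset.univ.erase l₀).biUnion fun l =>
          (Finset.univ.filter fun i : Fin m => (hS l).eigenvalues i ≠ 0).map ⟨fun i => (l, i), fun i j h => by
            simpa using h⟩ := by
    ext ⟨l, i⟩
    simp only [Finset.mem_filter, Finset.mem_univ, true_and, Finset.mem_biUnion, Finset.mem_erase, Finset.mem_map,
      Function.Embedding.coeFn_mk, Prod.mk.injEq, ne_eq]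
    constructor
    · rintro ⟨hl, hi⟩
      exact ⟨l, ⟨hl, trivial⟩, i, hi, rfl, rfl⟩
    · rintro ⟨l', ⟨hl', -⟩, i', hi', rfl, rfl⟩
      exact ⟨hl', hi'⟩
  rw [h, Finset.card_biUnion]
  · refine Finset.sum_congr rfl fun l _ => ?_
    rw [Finset.card_map, (hS l).rank_eq_card_non_zero_eigs, Fintype.card_subtype]
  · intro l _ l' _ hll'
    rw [Function.onFun, Finset.disjoint_left]
    intro x hx hx'
    simp only [Finset.mem_map, Finset.mem_filter, Finset.mem_univ, true_and, Function.Embedding.coeFn_mk] at hx hx'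
    obtain ⟨i, -, rfl⟩ := hx
    obtain ⟨i', -, h⟩ := hx'
    exact hll' (Prod.mk.inj h).1.symm

/-- **GRAM DUALITY FOR PENCILS (the crux's currency).**  Symmetric letters, ONE of them non-degenerate
(`det S_{l₀} ≠ 0`), `d_l ≤ E`: `Z₊(Σ_l X^{d_l} S_l)` equals `Z₊` of the dual pencil
`diag(σ_t⁻¹X^{E−d_{l(t)}}) + X^{E−d_{l₀}}·UᵀS_{l₀}⁻¹U` of size `Σ_{l≠l₀} rank S_l` (columns = non-zero eigen-columns of
the other letters, `σ` = their eigenvalues). [folklore] -/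
theorem card_posRoots_pencil_eq_dual (d : Fin K → ℕ) (S : Fin K → Matrix (Fin m) (Fin m) ℝ)
    (hS : ∀ l, (S l).IsHermitian) (l₀ : Fin K) (hS₀ : IsUnit (S l₀).det) (E : ℕ) (hE : ∀ l, d l ≤ E) :
    ((Matrix.det (∑ l, ((Polynomial.X : Polynomial ℝ) ^ d l) • (S l).map Polynomial.C)).roots.toFinset.filter
        (fun t => 0 < t)).card
      = ((Matrix.det (𝔻ₛ[E, d l₀, S l₀,
            (Matrix.of fun (a : Fin m) (t : {li : Fin K × Fin m // li.1 ≠ l₀ ∧ (hS li.1).eigenvalues li.2 ≠ 0}) =>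
              ((hS t.1.1).eigenvectorUnitary : Matrix (Fin m) (Fin m) ℝ) a t.1.2),
            (fun t : {li : Fin K × Fin m // li.1 ≠ l₀ ∧ (hS li.1).eigenvalues li.2 ≠ 0} =>
              (hS t.1.1).eigenvalues t.1.2),
            (fun t : {li : Fin K × Fin m // li.1 ≠ l₀ ∧ (hS li.1).eigenvalues li.2 ≠ 0} => d t.1.1)])
          ).roots.toFinset.filter (fun t => 0 < t)).card := by
  classical
  rw [pencil_eq_base_add_signedPart d S hS l₀]
  have h := posRoots_base_eq (S l₀) hS₀
    (Matrix.of fun (a : Fin m) (t : {li : Fin K × Fin m // li.1 ≠ l₀ ∧ (hS li.1).eigenvalues li.2 ≠ 0}) =>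
      ((hS t.1.1).eigenvectorUnitary : Matrix (Fin m) (Fin m) ℝ) a t.1.2)
    (fun t : {li : Fin K × Fin m // li.1 ≠ l₀ ∧ (hS li.1).eigenvalues li.2 ≠ 0} => (hS t.1.1).eigenvalues t.1.2)
    (fun t => t.2.2) (d l₀) E
    (fun t : {li : Fin K × Fin m // li.1 ≠ l₀ ∧ (hS li.1).eigenvalues li.2 ≠ 0} => d t.1.1) (hE l₀) (fun t => hE t.1.1)
  dsimp only at h ⊢
  rw [h]

end GramDual

end Summit.ValiantsHypothesis.ValiantsHypothesis.Theorems.LacunarySymmetroidMatrixDescartes
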